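import Mathlib
import HarnessLib
import Literature.Analysis.Approximation.InterpolationRemainder

/-!
# Tensor-product and Boolean-sum (blended) interpolation on rectangular grids

Source: G. Hämmerlin, K.-H. Hoffmann, *Numerical Mathematics* (Springer UTM, 1991), Ch. 5 §6.2–6.3
(interpolation on rectangular grids: the product operator `P = P_x P_y`, existence and uniqueness of
the tensor-product interpolation polynomial in `P_{nk}`, the splitting
`f - P f = (f - P_y f) + P_y (f - P_x f)`, the estimate `|(P g)(y)| ≤ ‖g‖_∞` for linear
interpolation and the **error bound for bilinear interpolation**
`‖f - Pf‖_∞ ≤ (1/8)(h_x² ‖D_x² f‖_∞ + h_y² ‖D_y² f‖_∞)`), Ch. 6 §5.1 (the cellwise bound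
`|f(x) - s(x)| ≤ (x_{ν+1} - x_ν)²/8 · max |f''|` for the interpolating linear spline) and §5.2 (the
interpolating linear spline is near-best: `‖f - s̃‖_∞ ≤ 2 ‖f - s‖_∞`), and Ch. 6 §6.1, §6.3
(bilinear splines as tensor products of linear B-splines; W. J. Gordon's **spline-blended
functions** `(P_x ⊕ P_y) f := P_x f + P_y f - P_x P_y f`, their **Interpolation Property** along
the grid lines,
and the **Error Bound for Spline-Blended Functions** with its Application
`‖f - σ‖_∞ ≤ h_x² h_y²/64 · ‖D_x² D_y² f‖_∞` in the linear case).
[cite: HammerlinHoffman1991, Ch. 5 §6.2–6.3; Ch. 6 §5.1–5.2, §6.1, §6.3]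

## What is typed

* §A (any commutative ring `R`, any `R`-module `M`): the **Boolean sum**
  `booleanSum P Q = P + Q - P Q`
  of two endomorphisms; `1 - (P ⊕ Q) = (1 - P)(1 - Q)`; symmetry and idempotency for commuting
  projectors; the splitting `f - PQf = (f - Pf) + P(f - Qf)` of 5.6.3; the precision statements:
  a linear functional / restriction map `E` with `E ∘ P = E` satisfies `E ∘ (P ⊕ Q) = E` (this is
  the computation behind the Interpolation Property of 6.6.3), `E ∘ (PQ) = E` needs both factors;
  the normed estimates `‖f - PQf‖ ≤ ‖f - Pf‖ + ‖P‖ ‖f - Qf‖`, `‖f - (P ⊕ Q)f‖ ≤ ‖1 - P‖ ‖f - Qf‖`.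
* §B (one variable): the two-point linear interpolation operator `linInterp a b g`, the polynomial
  `linInterpPoly a b g ∈ P_1` it evaluates, reproduction of the data and of affine functions,
  idempotency,
  `|(P g)(t)| ≤ max (|g a|, |g b|)` on `[a, b]`, the near-best bound of 6.5.2 on a cell, and the
  error bounds `|g(t) - (Pg)(t)| ≤ M/2 · (t - a)(b - t) ≤ M/8 · (b - a)²` for `g ∈ C²`, `|g''| ≤ M`
  (from the tree's remainder theorem `abs_interpolation_error_le`).
* §C (two variables, one grid cell `[x₀, x₁] × [y₀, y₁]`, `f : ℝ → ℝ → ℝ` curried): the partial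
  operators `interpX`, `interpY`, their commutation, the tensor product `tensorInterp` (= the
  bilinear interpolant, with its explicit four-term formula, interpolation at the four corners,
  reproduction of bilinear polynomials and uniqueness among them) and the Boolean sum
  `blendInterp` with the Interpolation Property on all four edges; the error identities
  `f - P_xP_y f = (f - P_y f) + P_y(f - P_x f)` and `f - (P_x ⊕ P_y) f = (I - P_y)(I - P_x) f`;
  the commutation `D_yⁿ (P_x f) = P_x (D_yⁿ f)`; the bilinear error bound of 5.6.3 and the blended
  error bound of 6.6.3 (case `r = 2`, `C₁ = C₂ = 1/8`).
* §D (polynomials): the Theorem of 5.6.2 — on an `(n+1) × (k+1)` grid of distinct abscissae and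
  ordinates there is exactly one `p ∈ ℝ[X][Y]` of degree `≤ n` in `x` and `≤ k` in `y` taking
  prescribed values (existence by products of Lagrange polynomials, uniqueness by the iterated
  one-dimensional argument of the text).

## Rendering notes

* The text works on a full grid `a = x₀ < ⋯ < x_n = b`, `c = y₀ < ⋯ < y_k = d`; every analytic
  statement of 5.6.3 / 6.6.1 / 6.6.3 typed here is local to one cell `[x₀, x₁] × [y₀, y₁]` (the
  bilinear spline of 6.6.1 restricted to a cell *is* the bilinear interpolant of the four corner
  values, and the sup-norm bounds of the text are the maxima of the cellwise bounds).  Sup norms are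
  rendered pointwise: hypotheses `|D² ·| ≤ M` on the cell, conclusions `|error (x, y)| ≤ …`.
* The general Error Bound for Spline-Blended Functions (arbitrary `r`, constants `C₁`, `C₂`) is an
  abstract statement about two operators satisfying (*) and the commutativity properties; it is
  typed in its concrete Application (`r = 2`, linear blending, `C = 1/8`), where the commutativity
  property `D_y² (P_x f) = P_x (D_y² f)` is a theorem (`iteratedDeriv_interpX`) rather than an
  assumption.  The bicubic bound of 6.6.2 (C. A. Hall 1968) is quoted by the text without proof and
  is not typed.
* Nearest tree neighbours: `Analysis.Approximation.InterpolationRemainder` (remainder term, used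
  here), `Analysis.Approximation.DividedDifferenceBSplines` and `UniformBSplines` (the linear
  B-splines of 6.6.1), `Analysis.Approximation.HermiteCubicSpline`; none treats tensor products or
  Boolean sums.
-/

open Set Polynomial
open scoped Nat

noncomputable section

namespace Literature.Analysis.Approximation.BooleanSumInterpolation

/-! ### §A Products and Boolean sums of two linear operators -/

section Abstract

variable {R M N : Type*} [CommRing R] [AddCommGroup M] [Module R M] [AddCommGroup N] [Module R N]

/-- The **Boolean sum** `P ⊕ Q := P + Q - P Q` of two linear operators (W. J. Gordon's blending).
[cite: HammerlinHoffman1991, Ch. 6 §6.3] -/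
def booleanSum (P Q : Module.End R M) : Module.End R M := P + Q - P * Q

variable (P Q : Module.End R M)

/-- `P ⊕ Q = P + Q - PQ`. [cite: HammerlinHoffman1991, Ch. 6 §6.3] -/
theorem booleanSum_def : booleanSum P Q = P + Q - P * Q := rfl

/-- `(P ⊕ Q) f = P f + Q f - P (Q f)`. [cite: HammerlinHoffman1991, Ch. 6 §6.3] -/
theorem booleanSum_apply (f : M) : booleanSum P Q f = P f + Q f - P (Q f) := by
  simp only [booleanSum, LinearMap.sub_apply, LinearMap.add_apply, Module.End.mul_apply]

/-- The remainder operator of a Boolean sum factors: `1 - (P ⊕ Q) = (1 - P)(1 - Q)`.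
[cite: HammerlinHoffman1991, Ch. 6 §6.3] -/
theorem one_sub_booleanSum : 1 - booleanSum P Q = (1 - P) * (1 - Q) := by
  rw [booleanSum]; noncomm_ring

/-- Pointwise form of the factorisation: `f - (P ⊕ Q) f = (f - Qf) - P (f - Qf)` (the identity that
opens the proof of the Error Bound for Spline-Blended Functions).
[cite: HammerlinHoffman1991, Ch. 6 §6.3] -/
theorem sub_booleanSum_apply (f : M) : f - booleanSum P Q f = (f - Q f) - P (f - Q f) := by
  rw [booleanSum_apply, map_sub]; abel

/-- Commuting operators have a symmetric Boolean sum: `P ⊕ Q = Q ⊕ P`.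
[cite: HammerlinHoffman1991, Ch. 6 §6.3] -/
theorem booleanSum_comm {P Q : Module.End R M} (h : P * Q = Q * P) :
    booleanSum P Q = booleanSum Q P := by
  rw [booleanSum, booleanSum, h]; abel

/-- For commuting operators also `f - (P ⊕ Q) f = (f - Pf) - Q (f - Pf)`.
[cite: HammerlinHoffman1991, Ch. 6 §6.3] -/
theorem sub_booleanSum_apply' {P Q : Module.End R M} (h : P * Q = Q * P) (f : M) :
    f - booleanSum P Q f = (f - P f) - Q (f - P f) := by
  rw [booleanSum_comm h, sub_booleanSum_apply]

/-- The splitting of the tensor-product error: `f - PQ f = (f - Pf) + P (f - Qf)`.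
[cite: HammerlinHoffman1991, Ch. 5 §6.3] -/
theorem sub_mul_apply (f : M) : f - (P * Q) f = (f - P f) + P (f - Q f) := by
  rw [Module.End.mul_apply, map_sub]; abel

/-- The Boolean sum of two commuting projectors is a projector.
[cite: HammerlinHoffman1991, Ch. 6 §6.3] -/
theorem booleanSum_mul_booleanSum {P Q : Module.End R M} (hP : P * P = P) (hQ : Q * Q = Q)
    (h : P * Q = Q * P) : booleanSum P Q * booleanSum P Q = booleanSum P Q := by
  have h1 : P * (P * Q) = P * Q := by rw [← mul_assoc, hP]
  have h3 : P * Q * P = P * Q := by rw [mul_assoc, ← h, ← mul_assoc, hP]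
  have h4 : P * Q * Q = P * Q := by rw [mul_assoc, hQ]
  have h2 : Q * (P * Q) = P * Q := by rw [← mul_assoc, ← h, h4]
  have h5 : P * Q * (P * Q) = P * Q := by rw [← mul_assoc, h3, h4]
  have e : (P + Q - P * Q) * (P + Q - P * Q) =
      P * P + P * Q - P * (P * Q) + (Q * P + Q * Q - Q * (P * Q))
        - (P * Q * P + P * Q * Q - P * Q * (P * Q)) := by
    noncomm_ring
  rw [booleanSum, e, hP, hQ, h1, h2, h3, h4, h5, ← h]
  abel

/-- The product of two commuting projectors is a projector (the tensor-product operator).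
[cite: HammerlinHoffman1991, Ch. 5 §6.3] -/
theorem mul_mul_mul_of_comm {P Q : Module.End R M} (hP : P * P = P) (hQ : Q * Q = Q)
    (h : P * Q = Q * P) : P * Q * (P * Q) = P * Q := by
  have h3 : P * Q * P = P * Q := by rw [mul_assoc, ← h, ← mul_assoc, hP]
  rw [← mul_assoc, h3, mul_assoc, hQ]

/-- A Boolean sum reproduces every element its second summand reproduces.
[cite: HammerlinHoffman1991, Ch. 6 §6.3] -/
theorem booleanSum_apply_of_right {f : M} (hf : Q f = f) : booleanSum P Q f = f := by
  rw [booleanSum_apply, hf]; abel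

/-- For commuting summands a Boolean sum also reproduces what its first summand reproduces.
[cite: HammerlinHoffman1991, Ch. 6 §6.3] -/
theorem booleanSum_apply_of_left {P Q : Module.End R M} (h : P * Q = Q * P) {f : M} (hf : P f = f) :
    booleanSum P Q f = f := by
  rw [booleanSum_comm h]; exact booleanSum_apply_of_right Q P hf

/-- The product `PQ` reproduces the elements both factors reproduce.
[cite: HammerlinHoffman1991, Ch. 5 §6.3] -/
theorem mul_apply_of_left_of_right {f : M} (hP : P f = f) (hQ : Q f = f) : (P * Q) f = f := by
  rw [Module.End.mul_apply, hQ, hP]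

/-- **Interpolation Property, abstract form.** If a linear map `E` (restriction to a grid line, a
point evaluation, …) is reproduced by `P`, i.e. `E ∘ P = E`, then it is reproduced by `P ⊕ Q`:
`E((P ⊕ Q) f) = E f + E(Qf) - E(Qf) = E f`. [cite: HammerlinHoffman1991, Ch. 6 §6.3] -/
theorem comp_booleanSum_of_comp_left (E : M →ₗ[R] N) (h : E ∘ₗ P = E) :
    E ∘ₗ booleanSum P Q = E := by
  ext f
  have hE : ∀ g, E (P g) = E g := fun g => LinearMap.congr_fun h g
  simp only [LinearMap.comp_apply, booleanSum_apply, map_sub, map_add, hE]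
  abel

/-- The same on the lines of the second family, using the symmetry of the Boolean sum of commuting
operators. [cite: HammerlinHoffman1991, Ch. 6 §6.3] -/
theorem comp_booleanSum_of_comp_right (E : M →ₗ[R] N) {P Q : Module.End R M} (hc : P * Q = Q * P)
    (h : E ∘ₗ Q = E) : E ∘ₗ booleanSum P Q = E := by
  rw [booleanSum_comm hc]; exact comp_booleanSum_of_comp_left Q P E h

/-- The tensor product reproduces `E` when both factors do (interpolation at the grid *points*).
[cite: HammerlinHoffman1991, Ch. 5 §6.3] -/
theorem comp_mul_of_comp (E : M →ₗ[R] N) (hP : E ∘ₗ P = E) (hQ : E ∘ₗ Q = E) :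
    E ∘ₗ (P * Q) = E := by
  ext f
  have hE : ∀ g, E (P g) = E g := fun g => LinearMap.congr_fun hP g
  have hE' : ∀ g, E (Q g) = E g := fun g => LinearMap.congr_fun hQ g
  simp only [LinearMap.comp_apply, Module.End.mul_apply, hE, hE']

end Abstract

section Normed

variable {𝕜 E : Type*} [NontriviallyNormedField 𝕜] [NormedAddCommGroup E] [NormedSpace 𝕜 E]

/-- `‖f - PQf‖ ≤ ‖f - Pf‖ + ‖P‖ · ‖f - Qf‖` (the first step of the Error Estimate of 5.6.3, written
with the factors in the order `P (Q f)`). [cite: HammerlinHoffman1991, Ch. 5 §6.3] -/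
theorem norm_sub_mul_le (P Q : E →L[𝕜] E) (f : E) :
    ‖f - P (Q f)‖ ≤ ‖f - P f‖ + ‖P‖ * ‖f - Q f‖ := by
  have h : f - P (Q f) = (f - P f) + P (f - Q f) := by rw [map_sub]; abel
  rw [h]
  exact (norm_add_le _ _).trans (by gcongr; exact P.le_opNorm _)

/-- `‖f - (P ⊕ Q) f‖ ≤ ‖1 - P‖ · ‖f - Qf‖`. [cite: HammerlinHoffman1991, Ch. 6 §6.3] -/
theorem norm_sub_booleanSum_le (P Q : E →L[𝕜] E) (f : E) :
    ‖f - (P f + Q f - P (Q f))‖ ≤ ‖(1 : E →L[𝕜] E) - P‖ * ‖f - Q f‖ := by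
  have h : f - (P f + Q f - P (Q f)) = ((1 : E →L[𝕜] E) - P) (f - Q f) := by
    simp only [sub_apply, one_apply_eq_self, map_sub]; abel
  rw [h]; exact ContinuousLinearMap.le_opNorm _ _

end Normed

/-! ### §B Two-point linear interpolation -/

section OneDim

variable {a b : ℝ}

/-- Linear interpolation at the nodes `a, b`:
`(P g)(t) = g(a) (b - t)/(b - a) + g(b) (t - a)/(b - a)`.
[cite: HammerlinHoffman1991, Ch. 5 §6.3] -/
def linInterp (a b : ℝ) (g : ℝ → ℝ) (t : ℝ) : ℝ :=
  g a * ((b - t) / (b - a)) + g b * ((t - a) / (b - a))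

/-- The interpolation polynomial `p ∈ P_1` behind `linInterp`.
[cite: HammerlinHoffman1991, Ch. 5 §6.3] -/
def linInterpPoly (a b : ℝ) (g : ℝ → ℝ) : ℝ[X] :=
  C ((g b - g a) / (b - a)) * X + C (g a - (g b - g a) / (b - a) * a)

/-- Unfolding `linInterp`. [cite: HammerlinHoffman1991, Ch. 5 §6.3] -/
theorem linInterp_apply (g : ℝ → ℝ) (t : ℝ) :
    linInterp a b g t = g a * ((b - t) / (b - a)) + g b * ((t - a) / (b - a)) := rfl

/-- `(P g)(a) = g(a)`. [cite: HammerlinHoffman1991, Ch. 5 §6.3] -/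
theorem linInterp_left (h : a ≠ b) (g : ℝ → ℝ) : linInterp a b g a = g a := by
  have hba : b - a ≠ 0 := sub_ne_zero.mpr h.symm
  simp [linInterp, hba]

/-- `(P g)(b) = g(b)`. [cite: HammerlinHoffman1991, Ch. 5 §6.3] -/
theorem linInterp_right (h : a ≠ b) (g : ℝ → ℝ) : linInterp a b g b = g b := by
  have hba : b - a ≠ 0 := sub_ne_zero.mpr h.symm
  simp [linInterp, hba]

/-- The two weights sum to one. [cite: HammerlinHoffman1991, Ch. 5 §6.3] -/
theorem weights_add (h : a ≠ b) (t : ℝ) : (b - t) / (b - a) + (t - a) / (b - a) = 1 := by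
  have hba : b - a ≠ 0 := sub_ne_zero.mpr h.symm
  rw [← add_div, show b - t + (t - a) = b - a by ring, div_self hba]

/-- On `[a, b]` the weights are nonnegative. [cite: HammerlinHoffman1991, Ch. 5 §6.3] -/
theorem weights_nonneg (hab : a < b) {t : ℝ} (ht : t ∈ Icc a b) :
    0 ≤ (b - t) / (b - a) ∧ 0 ≤ (t - a) / (b - a) :=
  ⟨div_nonneg (sub_nonneg.mpr ht.2) (sub_nonneg.mpr hab.le),
    div_nonneg (sub_nonneg.mpr ht.1) (sub_nonneg.mpr hab.le)⟩

/-- `P` is additive. [cite: HammerlinHoffman1991, Ch. 5 §6.3] -/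
theorem linInterp_add (g₁ g₂ : ℝ → ℝ) :
    linInterp a b (fun t => g₁ t + g₂ t) = fun t => linInterp a b g₁ t + linInterp a b g₂ t := by
  funext t; simp only [linInterp]; ring

/-- `P` respects differences. [cite: HammerlinHoffman1991, Ch. 5 §6.3] -/
theorem linInterp_sub (g₁ g₂ : ℝ → ℝ) :
    linInterp a b (fun t => g₁ t - g₂ t) = fun t => linInterp a b g₁ t - linInterp a b g₂ t := by
  funext t; simp only [linInterp]; ring

/-- `P` is homogeneous. [cite: HammerlinHoffman1991, Ch. 5 §6.3] -/
theorem linInterp_const_mul (c : ℝ) (g : ℝ → ℝ) :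
    linInterp a b (fun t => c * g t) = fun t => c * linInterp a b g t := by
  funext t; simp only [linInterp]; ring

/-- `P g` depends only on the two nodal values. [cite: HammerlinHoffman1991, Ch. 5 §6.3] -/
theorem linInterp_congr {g g' : ℝ → ℝ} (ha : g a = g' a) (hb : g b = g' b) :
    linInterp a b g = linInterp a b g' := by
  funext t; simp only [linInterp, ha, hb]

/-- `P` is idempotent: `P (P g) = P g`. [cite: HammerlinHoffman1991, Ch. 5 §6.3] -/
theorem linInterp_linInterp (h : a ≠ b) (g : ℝ → ℝ) :
    linInterp a b (linInterp a b g) = linInterp a b g :=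
  linInterp_congr (linInterp_left h g) (linInterp_right h g)

/-- `P` reproduces affine functions. [cite: HammerlinHoffman1991, Ch. 5 §6.3] -/
theorem linInterp_affine (h : a ≠ b) (c d : ℝ) :
    linInterp a b (fun t => c + d * t) = fun t => c + d * t := by
  have hba : b - a ≠ 0 := sub_ne_zero.mpr h.symm
  funext t; simp only [linInterp]; field_simp; ring

/-- `(P g)(t) = p(t)` with `p = linInterpPoly a b g`. [cite: HammerlinHoffman1991, Ch. 5 §6.3] -/
theorem eval_linInterpPoly (h : a ≠ b) (g : ℝ → ℝ) (t : ℝ) :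
    (linInterpPoly a b g).eval t = linInterp a b g t := by
  have hba : b - a ≠ 0 := sub_ne_zero.mpr h.symm
  simp only [linInterpPoly, linInterp, eval_add, eval_mul, eval_C, eval_X]
  field_simp
  ring

/-- `linInterpPoly a b g ∈ P_1`. [cite: HammerlinHoffman1991, Ch. 5 §6.3] -/
theorem degree_linInterpPoly_lt (g : ℝ → ℝ) : (linInterpPoly a b g).degree < 2 := degree_linear_lt

/-- `|(P g)(t)| ≤ max (|g a|, |g b|)` for `a ≤ t ≤ b` (the estimate `|(Pg)(y)| ≤ ‖g‖_∞` of the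
text).
[cite: HammerlinHoffman1991, Ch. 5 §6.3] -/
theorem abs_linInterp_le (hab : a < b) (g : ℝ → ℝ) {t : ℝ} (ht : t ∈ Icc a b) :
    |linInterp a b g t| ≤ max |g a| |g b| := by
  obtain ⟨h₀, h₁⟩ := weights_nonneg hab ht
  have hsum := weights_add hab.ne t
  calc |linInterp a b g t|
      ≤ |g a * ((b - t) / (b - a))| + |g b * ((t - a) / (b - a))| := abs_add_le _ _
    _ = |g a| * ((b - t) / (b - a)) + |g b| * ((t - a) / (b - a)) := by
        rw [abs_mul, abs_mul, abs_of_nonneg h₀, abs_of_nonneg h₁]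
    _ ≤ max |g a| |g b| * ((b - t) / (b - a)) + max |g a| |g b| * ((t - a) / (b - a)) := by
        gcongr
        · exact le_max_left _ _
        · exact le_max_right _ _
    _ = max |g a| |g b| := by rw [← mul_add, hsum, mul_one]

/-- Consequently `|(P g)(t)| ≤ K` whenever `|g a|, |g b| ≤ K`.
[cite: HammerlinHoffman1991, Ch. 5 §6.3] -/
theorem abs_linInterp_le_of_le (hab : a < b) {g : ℝ → ℝ} {K t : ℝ} (ht : t ∈ Icc a b)
    (ha : |g a| ≤ K) (hb : |g b| ≤ K) : |linInterp a b g t| ≤ K :=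
  (abs_linInterp_le hab g ht).trans (max_le ha hb)

/-- **Near-best property** (cell version of the Bound of 6.5.2): if `s` is reproduced by `P` and
`|f - s| ≤ ε` at `a`, `b` and `t`, then `|f(t) - (Pf)(t)| ≤ 2ε`.
[cite: HammerlinHoffman1991, Ch. 6 §5.2] -/
theorem abs_sub_linInterp_le_two_mul (hab : a < b) {f s : ℝ → ℝ} (hs : linInterp a b s = s)
    {ε t : ℝ} (ht : t ∈ Icc a b) (hεa : |f a - s a| ≤ ε) (hεb : |f b - s b| ≤ ε)
    (hεt : |f t - s t| ≤ ε) : |f t - linInterp a b f t| ≤ 2 * ε := by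
  have h1 : linInterp a b f t - s t = linInterp a b (fun u => f u - s u) t := by
    rw [linInterp_sub]
    simp only [hs]
  have h2 : |linInterp a b f t - s t| ≤ ε := by
    rw [h1]; exact abs_linInterp_le_of_le hab ht hεa hεb
  calc |f t - linInterp a b f t| = |(f t - s t) - (linInterp a b f t - s t)| := by ring_nf
    _ ≤ |f t - s t| + |linInterp a b f t - s t| := abs_sub _ _
    _ ≤ 2 * ε := by linarith

/-- **Error of linear interpolation, pointwise**: for `g ∈ C²[a, b]` with `|g''| ≤ M` there,
`|g(t) - (Pg)(t)| ≤ M/2 · (t - a)(b - t)` on `[a, b]` (from the remainder theorem with the two nodes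
`a, b`). [cite: HammerlinHoffman1991, Ch. 6 §5.1] -/
theorem abs_sub_linInterp_le_mul (hab : a < b) {g : ℝ → ℝ} (hg : ContDiff ℝ 2 g) {M : ℝ}
    (hM : ∀ x ∈ Icc a b, |iteratedDeriv 2 g x| ≤ M) {t : ℝ} (ht : t ∈ Icc a b) :
    |g t - linInterp a b g t| ≤ M / 2 * ((t - a) * (b - t)) := by
  classical
  have hne : a ≠ b := hab.ne
  have hcard : ({a, b} : Finset ℝ).card = 2 := Finset.card_pair hne
  have hfp : ∀ x ∈ ({a, b} : Finset ℝ), (linInterpPoly a b g).eval x = g x := by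
    intro x hx
    rcases Finset.mem_insert.mp hx with rfl | hx
    · rw [eval_linInterpPoly hne, linInterp_left hne]
    · rw [Finset.mem_singleton] at hx
      rw [hx, eval_linInterpPoly hne, linInterp_right hne]
  have hs : ∀ x ∈ ({a, b} : Finset ℝ), x ∈ Icc a b := by
    intro x hx
    rcases Finset.mem_insert.mp hx with rfl | hx
    · exact left_mem_Icc.mpr hab.le
    · rw [Finset.mem_singleton] at hx
      rw [hx]; exact right_mem_Icc.mpr hab.le
  have key :=
    abs_interpolation_error_le hcard two_pos hg (degree_linInterpPoly_lt g) hfp hab hs hM ht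
  rw [eval_linInterpPoly hne, Finset.prod_pair hne] at key
  have habs : |(t - a) * (t - b)| = (t - a) * (b - t) := by
    rw [abs_mul, abs_of_nonneg (sub_nonneg.mpr ht.1), abs_of_nonpos (sub_nonpos.mpr ht.2)]; ring
  have hfac : ((2 : ℕ)! : ℝ) = 2 := by norm_num [Nat.factorial]
  rw [habs, hfac] at key
  exact key

/-- **Error bound (**) for linear interpolation**: `|g(t) - (Pg)(t)| ≤ M/8 · (b - a)²` on `[a, b]`.
[cite: HammerlinHoffman1991, Ch. 6 §5.1] -/
theorem abs_sub_linInterp_le (hab : a < b) {g : ℝ → ℝ} (hg : ContDiff ℝ 2 g) {M : ℝ}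
    (hM : ∀ x ∈ Icc a b, |iteratedDeriv 2 g x| ≤ M) {t : ℝ} (ht : t ∈ Icc a b) :
    |g t - linInterp a b g t| ≤ M / 8 * (b - a) ^ 2 := by
  have h := abs_sub_linInterp_le_mul hab hg hM ht
  have hM0 : 0 ≤ M := (abs_nonneg _).trans (hM a (left_mem_Icc.mpr hab.le))
  have hq : (t - a) * (b - t) ≤ (b - a) ^ 2 / 4 := by nlinarith [sq_nonneg (t - a - (b - t))]
  calc |g t - linInterp a b g t| ≤ M / 2 * ((t - a) * (b - t)) := h
    _ ≤ M / 2 * ((b - a) ^ 2 / 4) := by gcongr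
    _ = M / 8 * (b - a) ^ 2 := by ring

end OneDim

/-! ### §C Two variables on a grid cell: tensor product and Boolean sum -/

section TwoDim

variable {x₀ x₁ y₀ y₁ : ℝ}

/-- `(P_x f)(x, y)`: linear interpolation in `x` at `x₀, x₁` for every fixed `y`.
[cite: HammerlinHoffman1991, Ch. 5 §6.3] -/
def interpX (x₀ x₁ : ℝ) (f : ℝ → ℝ → ℝ) (x y : ℝ) : ℝ := linInterp x₀ x₁ (fun s => f s y) x

/-- `(P_y f)(x, y)`: linear interpolation in `y` at `y₀, y₁` for every fixed `x`.
[cite: HammerlinHoffman1991, Ch. 5 §6.3] -/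
def interpY (y₀ y₁ : ℝ) (f : ℝ → ℝ → ℝ) (x y : ℝ) : ℝ := linInterp y₀ y₁ (f x) y

/-- The tensor-product (bilinear) interpolant `P f = P_x P_y f` on the cell `[x₀, x₁] × [y₀, y₁]`.
[cite: HammerlinHoffman1991, Ch. 5 §6.3; Ch. 6 §6.1] -/
def tensorInterp (x₀ x₁ y₀ y₁ : ℝ) (f : ℝ → ℝ → ℝ) : ℝ → ℝ → ℝ :=
  interpX x₀ x₁ (interpY y₀ y₁ f)

/-- The (linearly) blended function `σ = (P_x ⊕ P_y) f = P_x f + P_y f - P_x P_y f`.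
[cite: HammerlinHoffman1991, Ch. 6 §6.3] -/
def blendInterp (x₀ x₁ y₀ y₁ : ℝ) (f : ℝ → ℝ → ℝ) (x y : ℝ) : ℝ :=
  interpX x₀ x₁ f x y + interpY y₀ y₁ f x y - interpX x₀ x₁ (interpY y₀ y₁ f) x y

/-- Unfolding `P_x`. [cite: HammerlinHoffman1991, Ch. 5 §6.3] -/
theorem interpX_apply (f : ℝ → ℝ → ℝ) (x y : ℝ) : interpX x₀ x₁ f x y =
    f x₀ y * ((x₁ - x) / (x₁ - x₀)) + f x₁ y * ((x - x₀) / (x₁ - x₀)) := rfl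

/-- Unfolding `P_y`. [cite: HammerlinHoffman1991, Ch. 5 §6.3] -/
theorem interpY_apply (f : ℝ → ℝ → ℝ) (x y : ℝ) : interpY y₀ y₁ f x y =
    f x y₀ * ((y₁ - y) / (y₁ - y₀)) + f x y₁ * ((y - y₀) / (y₁ - y₀)) := rfl

/-- `P_x P_y = P_y P_x`. [cite: HammerlinHoffman1991, Ch. 5 §6.3] -/
theorem interpX_interpY_comm (f : ℝ → ℝ → ℝ) :
    interpX x₀ x₁ (interpY y₀ y₁ f) = interpY y₀ y₁ (interpX x₀ x₁ f) := by
  funext x y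
  simp only [interpX, interpY, linInterp]
  ring

/-- The bilinear interpolant written out: the four corner values times the products of the weights
(the basis functions `B^x_{1ν} B^y_{1κ}` of 6.6.1 restricted to one cell).
[cite: HammerlinHoffman1991, Ch. 6 §6.1] -/
theorem tensorInterp_apply (f : ℝ → ℝ → ℝ) (x y : ℝ) : tensorInterp x₀ x₁ y₀ y₁ f x y =
    f x₀ y₀ * ((x₁ - x) / (x₁ - x₀)) * ((y₁ - y) / (y₁ - y₀))
      + f x₀ y₁ * ((x₁ - x) / (x₁ - x₀)) * ((y - y₀) / (y₁ - y₀))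
      + f x₁ y₀ * ((x - x₀) / (x₁ - x₀)) * ((y₁ - y) / (y₁ - y₀))
      + f x₁ y₁ * ((x - x₀) / (x₁ - x₀)) * ((y - y₀) / (y₁ - y₀)) := by
  simp only [tensorInterp, interpX, interpY, linInterp]
  ring

/-- `P_x` interpolates along the vertical grid lines `x = x₀`, `x = x₁`.
[cite: HammerlinHoffman1991, Ch. 6 §6.3] -/
theorem interpX_apply_node (hx : x₀ ≠ x₁) (f : ℝ → ℝ → ℝ) {a : ℝ} (ha : a = x₀ ∨ a = x₁)
    (y : ℝ) : interpX x₀ x₁ f a y = f a y := by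
  rcases ha with rfl | rfl
  · exact linInterp_left hx _
  · exact linInterp_right hx _

/-- `P_y` interpolates along the horizontal grid lines `y = y₀`, `y = y₁`.
[cite: HammerlinHoffman1991, Ch. 6 §6.3] -/
theorem interpY_apply_node (hy : y₀ ≠ y₁) (f : ℝ → ℝ → ℝ) (x : ℝ) {b : ℝ} (hb : b = y₀ ∨ b = y₁) :
    interpY y₀ y₁ f x b = f x b := by
  rcases hb with rfl | rfl
  · exact linInterp_left hy _
  · exact linInterp_right hy _

/-- The tensor product interpolates at the four grid points.
[cite: HammerlinHoffman1991, Ch. 5 §6.3; Ch. 6 §6.1] -/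
theorem tensorInterp_apply_node (hx : x₀ ≠ x₁) (hy : y₀ ≠ y₁) (f : ℝ → ℝ → ℝ) {a b : ℝ}
    (ha : a = x₀ ∨ a = x₁) (hb : b = y₀ ∨ b = y₁) : tensorInterp x₀ x₁ y₀ y₁ f a b = f a b := by
  rw [tensorInterp, interpX_apply_node hx _ ha, interpY_apply_node hy _ _ hb]

/-- **Interpolation Property**, vertical lines: `σ(x_ν, y) = f(x_ν, y)` for all `y`.
[cite: HammerlinHoffman1991, Ch. 6 §6.3] -/
theorem blendInterp_apply_left_right (hx : x₀ ≠ x₁) (f : ℝ → ℝ → ℝ) {a : ℝ}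
    (ha : a = x₀ ∨ a = x₁) (y : ℝ) : blendInterp x₀ x₁ y₀ y₁ f a y = f a y := by
  rw [blendInterp, interpX_apply_node hx _ ha, interpX_apply_node hx _ ha]
  ring

/-- **Interpolation Property**, horizontal lines: `σ(x, y_κ) = f(x, y_κ)` for all `x` (this uses the
symmetry `P_x P_y = P_y P_x`). [cite: HammerlinHoffman1991, Ch. 6 §6.3] -/
theorem blendInterp_apply_bottom_top (hy : y₀ ≠ y₁) (f : ℝ → ℝ → ℝ) (x : ℝ) {b : ℝ}
    (hb : b = y₀ ∨ b = y₁) : blendInterp x₀ x₁ y₀ y₁ f x b = f x b := by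
  rw [blendInterp, interpX_interpY_comm, interpY_apply_node hy _ _ hb,
    interpY_apply_node hy _ _ hb]
  ring

/-- The blended function written with the factors in the other order.
[cite: HammerlinHoffman1991, Ch. 6 §6.3] -/
theorem blendInterp_eq (f : ℝ → ℝ → ℝ) (x y : ℝ) : blendInterp x₀ x₁ y₀ y₁ f x y =
    interpX x₀ x₁ f x y + interpY y₀ y₁ f x y - interpY y₀ y₁ (interpX x₀ x₁ f) x y := by
  rw [blendInterp, interpX_interpY_comm]

/-- Error splitting for the tensor product: `f - P_x P_y f = (f - P_y f) + P_y (f - P_x f)`.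
[cite: HammerlinHoffman1991, Ch. 5 §6.3] -/
theorem sub_tensorInterp_eq (f : ℝ → ℝ → ℝ) (x y : ℝ) :
    f x y - tensorInterp x₀ x₁ y₀ y₁ f x y = (f x y - interpY y₀ y₁ f x y)
      + interpY y₀ y₁ (fun u v => f u v - interpX x₀ x₁ f u v) x y := by
  simp only [tensorInterp, interpX, interpY, linInterp]
  ring

/-- Error factorisation for the Boolean sum: `f - σ = (I - P_y)((I - P_x) f)`, i.e. at `(x, y)` the
error is the `y`-interpolation error of `y ↦ f(x, y) - (P_x f)(x, y)`.
[cite: HammerlinHoffman1991, Ch. 6 §6.3] -/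
theorem sub_blendInterp_eq (f : ℝ → ℝ → ℝ) (x y : ℝ) :
    f x y - blendInterp x₀ x₁ y₀ y₁ f x y = (f x y - interpX x₀ x₁ f x y)
      - interpY y₀ y₁ (fun u v => f u v - interpX x₀ x₁ f u v) x y := by
  simp only [blendInterp, interpX, interpY, linInterp]
  ring

/-- The tensor product depends only on the four corner values.
[cite: HammerlinHoffman1991, Ch. 6 §6.1] -/
theorem tensorInterp_congr {f g : ℝ → ℝ → ℝ}
    (h : ∀ a b, (a = x₀ ∨ a = x₁) → (b = y₀ ∨ b = y₁) → f a b = g a b) :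
    tensorInterp x₀ x₁ y₀ y₁ f = tensorInterp x₀ x₁ y₀ y₁ g := by
  funext x y
  rw [tensorInterp_apply, tensorInterp_apply, h x₀ y₀ (Or.inl rfl) (Or.inl rfl),
    h x₀ y₁ (Or.inl rfl) (Or.inr rfl), h x₁ y₀ (Or.inr rfl) (Or.inl rfl),
    h x₁ y₁ (Or.inr rfl) (Or.inr rfl)]

/-- The tensor product reproduces the bilinear polynomials `P_{11}`.
[cite: HammerlinHoffman1991, Ch. 5 §6.2] -/
theorem tensorInterp_bilinear (hx : x₀ ≠ x₁) (hy : y₀ ≠ y₁) (α β γ δ : ℝ) :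
    tensorInterp x₀ x₁ y₀ y₁ (fun x y => α + β * x + γ * y + δ * x * y)
      = fun x y => α + β * x + γ * y + δ * x * y := by
  have h1 : x₁ - x₀ ≠ 0 := sub_ne_zero.mpr hx.symm
  have h2 : y₁ - y₀ ≠ 0 := sub_ne_zero.mpr hy.symm
  funext x y
  rw [tensorInterp_apply]
  field_simp
  ring

/-- **Uniqueness in `P_{11}`**: a bilinear polynomial taking the values of `f` at the four corners
of a nondegenerate cell is the tensor-product interpolant.
[cite: HammerlinHoffman1991, Ch. 5 §6.2] -/
theorem bilinear_eq_tensorInterp (hx : x₀ ≠ x₁) (hy : y₀ ≠ y₁) {α β γ δ : ℝ} {f : ℝ → ℝ → ℝ}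
    (h : ∀ a b, (a = x₀ ∨ a = x₁) → (b = y₀ ∨ b = y₁) → α + β * a + γ * b + δ * a * b = f a b) :
    (fun x y => α + β * x + γ * y + δ * x * y) = tensorInterp x₀ x₁ y₀ y₁ f := by
  rw [← tensorInterp_bilinear hx hy α β γ δ]
  exact tensorInterp_congr h

/-- `σ` reproduces every `f` that `P_y` reproduces. [cite: HammerlinHoffman1991, Ch. 6 §6.3] -/
theorem blendInterp_of_interpY_eq {f : ℝ → ℝ → ℝ} (h : interpY y₀ y₁ f = f) :
    blendInterp x₀ x₁ y₀ y₁ f = f := by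
  funext x y
  rw [blendInterp, h]
  ring

/-- `σ` reproduces every `f` that `P_x` reproduces. [cite: HammerlinHoffman1991, Ch. 6 §6.3] -/
theorem blendInterp_of_interpX_eq {f : ℝ → ℝ → ℝ} (h : interpX x₀ x₁ f = f) :
    blendInterp x₀ x₁ y₀ y₁ f = f := by
  funext x y
  rw [blendInterp_eq, h]
  ring

/-- **Commutativity property** `D_yⁿ (P_x f) = P_x (D_yⁿ f)` (differentiation in `y` commutes with
interpolation in `x`). [cite: HammerlinHoffman1991, Ch. 5 §6.3; Ch. 6 §6.3] -/
theorem iteratedDeriv_interpX (n : ℕ) {f : ℝ → ℝ → ℝ} (h₀ : ContDiff ℝ n (f x₀))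
    (h₁ : ContDiff ℝ n (f x₁)) (x y : ℝ) :
    iteratedDeriv n (fun v => interpX x₀ x₁ f x v) y
      = interpX x₀ x₁ (fun u v => iteratedDeriv n (f u) v) x y := by
  have e : (fun v => interpX x₀ x₁ f x v)
      = fun v => (fun v => f x₀ v * ((x₁ - x) / (x₁ - x₀))) v
          + (fun v => f x₁ v * ((x - x₀) / (x₁ - x₀))) v := rfl
  rw [e, iteratedDeriv_fun_add ((h₀.mul contDiff_const).contDiffAt)
    ((h₁.mul contDiff_const).contDiffAt), iteratedDeriv_mul_const_field,
    iteratedDeriv_mul_const_field]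
  rfl

/-- `|(P_y g)(x, y)| ≤ max (|g(x, y₀)|, |g(x, y₁)|)` for `y₀ ≤ y ≤ y₁`.
[cite: HammerlinHoffman1991, Ch. 5 §6.3] -/
theorem abs_interpY_le (hy : y₀ < y₁) (g : ℝ → ℝ → ℝ) (x : ℝ) {y : ℝ} (hym : y ∈ Icc y₀ y₁) :
    |interpY y₀ y₁ g x y| ≤ max |g x y₀| |g x y₁| :=
  abs_linInterp_le hy (g x) hym

/-- **Error Bound for Bilinear Interpolation**: if `|D_x² f| ≤ M_x` on the two horizontal edges and
`|D_y² f| ≤ M_y` on the cell, then `|f - Pf| ≤ (1/8)(M_x h_x² + M_y h_y²)` on the cell.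
[cite: HammerlinHoffman1991, Ch. 5 §6.3; Ch. 6 §6.1] -/
theorem abs_sub_tensorInterp_le (hx : x₀ < x₁) (hy : y₀ < y₁) {f : ℝ → ℝ → ℝ} {Mx My : ℝ}
    (hfx : ∀ b, (b = y₀ ∨ b = y₁) → ContDiff ℝ 2 (fun s => f s b) ∧
      ∀ s ∈ Icc x₀ x₁, |iteratedDeriv 2 (fun s => f s b) s| ≤ Mx)
    (hfy : ∀ x ∈ Icc x₀ x₁, ContDiff ℝ 2 (f x) ∧ ∀ y ∈ Icc y₀ y₁, |iteratedDeriv 2 (f x) y| ≤ My)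
    {x y : ℝ} (hxm : x ∈ Icc x₀ x₁) (hym : y ∈ Icc y₀ y₁) :
    |f x y - tensorInterp x₀ x₁ y₀ y₁ f x y|
      ≤ Mx / 8 * (x₁ - x₀) ^ 2 + My / 8 * (y₁ - y₀) ^ 2 := by
  rw [sub_tensorInterp_eq]
  have h1 : |f x y - interpY y₀ y₁ f x y| ≤ My / 8 * (y₁ - y₀) ^ 2 :=
    abs_sub_linInterp_le hy (hfy x hxm).1 (hfy x hxm).2 hym
  have hedge : ∀ b, (b = y₀ ∨ b = y₁) →
      |f x b - interpX x₀ x₁ f x b| ≤ Mx / 8 * (x₁ - x₀) ^ 2 := fun b hb =>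
    abs_sub_linInterp_le hx (hfx b hb).1 (hfx b hb).2 hxm
  have h2 : |interpY y₀ y₁ (fun u v => f u v - interpX x₀ x₁ f u v) x y|
      ≤ Mx / 8 * (x₁ - x₀) ^ 2 :=
    abs_linInterp_le_of_le hy hym (hedge y₀ (Or.inl rfl)) (hedge y₁ (Or.inr rfl))
  calc _ ≤ |f x y - interpY y₀ y₁ f x y|
        + |interpY y₀ y₁ (fun u v => f u v - interpX x₀ x₁ f u v) x y| := abs_add_le _ _
    _ ≤ My / 8 * (y₁ - y₀) ^ 2 + Mx / 8 * (x₁ - x₀) ^ 2 := add_le_add h1 h2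
    _ = _ := by ring

/-- **Error Bound for Spline-Blended Functions**, linear case (`r = 2`, `C₁ = C₂ = 1/8`):
`|f - σ| ≤ h_x² h_y²/64 · M` on the cell when `|D_x² D_y² f| ≤ M` there.  Hypotheses: every
section `f(x, ·)` is `C²`, and for each `y` the mixed slice `s ↦ D_y² f(s, y)` is `C²` in `s` with
`|D_s² D_y² f| ≤ M`. [cite: HammerlinHoffman1991, Ch. 6 §6.3] -/
theorem abs_sub_blendInterp_le (hx : x₀ < x₁) (hy : y₀ < y₁) {f : ℝ → ℝ → ℝ} {M : ℝ}
    (hfy : ∀ x ∈ Icc x₀ x₁, ContDiff ℝ 2 (f x))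
    (hD : ∀ y ∈ Icc y₀ y₁, ContDiff ℝ 2 (fun s => iteratedDeriv 2 (f s) y) ∧
      ∀ s ∈ Icc x₀ x₁, |iteratedDeriv 2 (fun s => iteratedDeriv 2 (f s) y) s| ≤ M)
    {x y : ℝ} (hxm : x ∈ Icc x₀ x₁) (hym : y ∈ Icc y₀ y₁) :
    |f x y - blendInterp x₀ x₁ y₀ y₁ f x y| ≤ M / 64 * ((x₁ - x₀) ^ 2 * (y₁ - y₀) ^ 2) := by
  have hx₀ : x₀ ∈ Icc x₀ x₁ := left_mem_Icc.mpr hx.le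
  have hx₁ : x₁ ∈ Icc x₀ x₁ := right_mem_Icc.mpr hx.le
  -- the function `g = (I - P_x) f (x, ·)` and its second derivative
  set g : ℝ → ℝ := fun v => f x v - interpX x₀ x₁ f x v with hg
  have hPx : ContDiff ℝ 2 (fun v => interpX x₀ x₁ f x v) :=
    ((hfy x₀ hx₀).mul contDiff_const).add ((hfy x₁ hx₁).mul contDiff_const)
  have hgc : ContDiff ℝ 2 g := (hfy x hxm).sub hPx
  have hg2 : ∀ v, iteratedDeriv 2 g v = (fun s => iteratedDeriv 2 (f s) v) x
      - interpX x₀ x₁ (fun u w => iteratedDeriv 2 (f u) w) x v := by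
    intro v
    rw [hg, iteratedDeriv_fun_sub (hfy x hxm).contDiffAt hPx.contDiffAt,
      iteratedDeriv_interpX 2 (hfy x₀ hx₀) (hfy x₁ hx₁)]
  -- `|g''| ≤ M/8 · h_x²` on `[y₀, y₁]`: the `x`-interpolation error of `s ↦ D_y² f(s, v)`
  have hgM : ∀ v ∈ Icc y₀ y₁, |iteratedDeriv 2 g v| ≤ M / 8 * (x₁ - x₀) ^ 2 := by
    intro v hv
    rw [hg2 v]
    exact abs_sub_linInterp_le hx (hD v hv).1 (hD v hv).2 hxm
  have key := abs_sub_linInterp_le hy hgc hgM hym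
  rw [sub_blendInterp_eq]
  calc _ = |g y - linInterp y₀ y₁ g y| := by rfl
    _ ≤ M / 8 * (x₁ - x₀) ^ 2 / 8 * (y₁ - y₀) ^ 2 := key
    _ = _ := by ring

end TwoDim

/-! ### §D The tensor-product interpolation polynomial in `P_{nk}` -/

section TensorPolynomial

/-- **Uniqueness** (Theorem 5.6.2): a polynomial of degree `≤ k` in `y` whose coefficients have
degree `≤ n` in `x`, vanishing at all points of an `(n+1) × (k+1)` grid with distinct abscissae and
distinct ordinates, is zero — first each `p(x_ν, ·)` vanishes identically, then each coefficient
does.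
[cite: HammerlinHoffman1991, Ch. 5 §6.2] -/
theorem eq_zero_of_evalEval_grid {n k : ℕ} {x : Fin (n + 1) → ℝ} {y : Fin (k + 1) → ℝ}
    (hx : Function.Injective x) (hy : Function.Injective y) {p : ℝ[X][X]}
    (hk : p.natDegree ≤ k) (hn : ∀ i, (p.coeff i).natDegree ≤ n)
    (h0 : ∀ ν κ, p.evalEval (x ν) (y κ) = 0) : p = 0 := by
  -- each `p(x_ν, ·)` is the zero polynomial
  have hq : ∀ ν, p.map (evalRingHom (x ν)) = 0 := by
    intro ν
    refine Polynomial.eq_zero_of_natDegree_lt_card_of_eval_eq_zero _ hy ?_ ?_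
    · intro κ
      rw [map_evalRingHom_eval]
      exact h0 ν κ
    · rw [Fintype.card_fin]
      exact lt_of_le_of_lt (natDegree_map_le.trans hk) (Nat.lt_succ_self k)
  -- hence every coefficient vanishes at every `x_ν`
  ext i : 1
  rw [coeff_zero]
  refine Polynomial.eq_zero_of_natDegree_lt_card_of_eval_eq_zero _ hx ?_ ?_
  · intro ν
    have := congrArg (fun q => q.coeff i) (hq ν)
    simpa only [coeff_map, coe_evalRingHom, coeff_zero] using this
  · rw [Fintype.card_fin]
    exact lt_of_le_of_lt (hn i) (Nat.lt_succ_self n)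

/-- Uniqueness of the interpolating polynomial in `P_{nk}`.
[cite: HammerlinHoffman1991, Ch. 5 §6.2] -/
theorem tensorPoly_unique {n k : ℕ} {x : Fin (n + 1) → ℝ} {y : Fin (k + 1) → ℝ}
    (hx : Function.Injective x) (hy : Function.Injective y) {p q : ℝ[X][X]}
    (hpk : p.natDegree ≤ k) (hpn : ∀ i, (p.coeff i).natDegree ≤ n)
    (hqk : q.natDegree ≤ k) (hqn : ∀ i, (q.coeff i).natDegree ≤ n)
    (h : ∀ ν κ, p.evalEval (x ν) (y κ) = q.evalEval (x ν) (y κ)) : p = q := by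
  refine sub_eq_zero.mp (eq_zero_of_evalEval_grid hx hy ?_ ?_ ?_)
  · exact (natDegree_sub_le _ _).trans (max_le hpk hqk)
  · intro i
    rw [coeff_sub]
    exact (natDegree_sub_le _ _).trans (max_le (hpn i) (hqn i))
  · intro ν κ
    rw [evalEval_sub, h ν κ, sub_self]

/-- **Existence** (Theorem 5.6.2): `p = ∑_κ (∑_ν f(x_ν, y_κ) ℓ_{nν}(X)) · ℓ_{kκ}(Y)` built from the
one-dimensional Lagrange polynomials lies in `P_{nk}` and interpolates.
[cite: HammerlinHoffman1991, Ch. 5 §6.2] -/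
theorem exists_tensorPoly {n k : ℕ} {x : Fin (n + 1) → ℝ} {y : Fin (k + 1) → ℝ}
    (hx : Function.Injective x) (hy : Function.Injective y) (f : Fin (n + 1) → Fin (k + 1) → ℝ) :
    ∃ p : ℝ[X][X], p.natDegree ≤ k ∧ (∀ i, (p.coeff i).natDegree ≤ n) ∧
      ∀ ν κ, p.evalEval (x ν) (y κ) = f ν κ := by
  classical
  set Lx : Fin (n + 1) → ℝ[X] := fun ν => Lagrange.basis Finset.univ x ν with hLx
  set Ly : Fin (k + 1) → ℝ[X] := fun κ => Lagrange.basis Finset.univ y κ with hLy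
  have hxs : Set.InjOn x (Finset.univ : Finset (Fin (n + 1))) := hx.injOn
  have hys : Set.InjOn y (Finset.univ : Finset (Fin (k + 1))) := hy.injOn
  have hLxdeg : ∀ ν, (Lx ν).natDegree ≤ n := fun ν => by
    rw [hLx, Lagrange.natDegree_basis hxs (Finset.mem_univ ν), Finset.card_univ, Fintype.card_fin]
    omega
  have hLydeg : ∀ κ, (Ly κ).natDegree ≤ k := fun κ => by
    rw [hLy, Lagrange.natDegree_basis hys (Finset.mem_univ κ), Finset.card_univ, Fintype.card_fin]
    omega
  have hLxev : ∀ ν μ, (Lx ν).eval (x μ) = if ν = μ then 1 else 0 := by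
    intro ν μ
    split_ifs with h
    · subst h; exact Lagrange.eval_basis_self hxs (Finset.mem_univ ν)
    · exact Lagrange.eval_basis_of_ne h (Finset.mem_univ μ)
  have hLyev : ∀ κ μ, (Ly κ).eval (y μ) = if κ = μ then 1 else 0 := by
    intro κ μ
    split_ifs with h
    · subst h; exact Lagrange.eval_basis_self hys (Finset.mem_univ κ)
    · exact Lagrange.eval_basis_of_ne h (Finset.mem_univ μ)
  refine ⟨∑ κ, C (∑ ν, C (f ν κ) * Lx ν) * (Ly κ).map C, ?_, ?_, ?_⟩
  · refine natDegree_sum_le_of_forall_le _ _ fun κ _ => ?_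
    exact (natDegree_C_mul_le _ _).trans (natDegree_map_le.trans (hLydeg κ))
  · intro i
    rw [finsetSum_coeff]
    refine natDegree_sum_le_of_forall_le _ _ fun κ _ => ?_
    rw [coeff_C_mul, coeff_map]
    refine (natDegree_mul_C_le _ _).trans ?_
    refine natDegree_sum_le_of_forall_le _ _ fun ν _ => ?_
    exact (natDegree_C_mul_le _ _).trans (hLxdeg ν)
  · intro ν κ
    simp only [evalEval_finsetSum, evalEval_mul, evalEval_C, evalEval_map_C, eval_finsetSum,
      eval_mul, eval_C, hLxev, hLyev, mul_ite, mul_one, mul_zero, Finset.sum_ite_eq',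
      Finset.mem_univ, if_true]

end TensorPolynomial

end Literature.Analysis.Approximation.BooleanSumInterpolation

end
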